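import Mathlib
import Literature.Analysis.FluidPDE.ClassicalSuitable
import Summits.NavierStokesRegularity.NavierStokesRegularity.Theses.EulerZoomLiouville

/-!
# Crux `EulerZoomLiouville.PowerGaugeEulerLiouville` (stmt-NavierStokesRegularity-19832) — negative edge:
# a BUDGETED CLASSICAL ANCIENT EULER FLOW refutes the crux for every `ρ ∈ (0, ½]` at once

Negative-lane record (prover hand leafhand-ns-eulerzoomliouville-8 g0; `--supports` stmt-19832).  The crux asks, for
every `ρ > 0`, that every suitable weak Euler pair `(u,p)` on the slab `(−∞,0) × ℝ³` with a weak spatial gradient `H`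
and Seregin's power-gauged bound `a^{2ρ}A(a) + a^{ρ}E(a) + a^{2ρ}D(a) ≤ c` (all `a > 0`, cylinders `Q_a(0,0)`) be
a.e. zero.  The rung `ρ > ½` is proved; the window `0 < ρ ≤ ½` is open (Chae–Shvydkoy).

This file isolates, in the weakest CLASSICAL currency, what a counterexample in the window needs.  Let `(u,p)` be a
classical (jointly `C^∞`) Euler flow on `(−∞,0) × ℝ³` (`IsClassicalEulerSolutionOn (Iio 0) 0 u p`) with THREE FINITE
GLOBAL BUDGETS
* energy `∫_{ℝ³} |u(t)|² ≤ M` for every `t < 0`,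
* space–time enstrophy `∫_{−∞}^{0} ∫_{ℝ³} |∇u|²_F ≤ M`,
* space–time pressure `∫_{−∞}^{0} ∫_{ℝ³} |p|^{3/2} ≤ M`,
and bounded velocity / gradient / pressure on the unit cylinder `(−1,0) × B₁` below the vertex (the class allows
blow-up at the final time, so this is a genuine extra hypothesis).  Then (`powerGauge_hypotheses_of_budgets`) the
triple `(u, p, ∇u)` satisfies the three hypotheses of the crux VERBATIM for EVERY `ρ ∈ [0, ½]` (large scales: the
budgets, `a^{2ρ−1}, a^{ρ−1}, a^{2ρ−2} ≤ 1`; small scales: the local bounds, `|Q_a| = a⁵|B₁|`), and hence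
(`powerGaugeEulerLiouville_false_of_ancientBudgetedClassicalFlow`) a NONZERO such flow refutes the crux.

Time-reversal remark (not formalised, classical solutions only): `u(t,x) ↦ −u(−t,x)`, `p(t,x) ↦ p(−t,x)` maps such
ancient flows bijectively onto FORWARD global classical finite-energy Euler flows on `(0,∞) × ℝ³` whose enstrophy is
square-summable in time, `∫₀^∞ ‖∇u(s)‖²_{L²} ds < ∞` («relaxation to rest in `Ḣ¹` at constant energy»), with
`∫₀^∞‖p‖_{3/2}^{3/2} < ∞`; so the window of the crux is refuted by ANY such relaxing global solution.  None is known: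
steady and travelling members are excluded (tree: `powerGauge_steady_ae_eq_zero_of_sum`; a travelling structure misses
gauge `E` by `a^{ρ}`); for smooth flows with a closed vortex tube of flux `Γ` and volume `V`, Kelvin + incompressibility
heuristically bound the enstrophy below by `≍ Γ²/V^{1/3}`.

WHAT THIS IS NOT: not a refutation of the crux, of a stub, or of the route; not a claim about Navier–Stokes; the
hypothesis object (a budgeted nonzero classical ancient Euler flow) is NOT constructed here and is not known to exist.
[folklore] -/

noncomputable section
set_option linter.dupNamespace false
namespace Summit.NavierStokesRegularity.NavierStokesRegularity.Theorems.PowerGaugeEulerLiouville.Negative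

open MeasureTheory Set Function Filter Topology Metric Literature.Analysis Literature.Analysis.FluidPDE
open scoped NNReal ENNReal Laplacian

/-! ## `ℝ≥0∞` bookkeeping -/

/-- `x ≤ c` with `c` finite and nonzero gives `x · (c⁻¹ · I) ≤ I`. [folklore] -/
theorem mul_inv_mul_le_of_le {x c I : ℝ≥0∞} (hxc : x ≤ c) (hc0 : c ≠ 0) (hc : c ≠ ⊤) :
    x * (c⁻¹ * I) ≤ I := by
  calc x * (c⁻¹ * I) ≤ c * (c⁻¹ * I) := mul_le_mul_left hxc _
    _ = I := by rw [← mul_assoc, ENNReal.mul_inv_cancel hc0 hc, one_mul]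

/-- For `a ≥ 1` and `θ ≤ 1`: `ofReal (a^θ) ≤ ofReal a`. [folklore] -/
theorem ofReal_rpow_le_ofReal {a θ : ℝ} (ha : 1 ≤ a) (hθ : θ ≤ 1) :
    ENNReal.ofReal (a ^ θ) ≤ ENNReal.ofReal a := by
  refine ENNReal.ofReal_le_ofReal ?_
  calc a ^ θ ≤ a ^ (1 : ℝ) := Real.rpow_le_rpow_of_exponent_le ha hθ
    _ = a := Real.rpow_one a

/-- For `0 < a ≤ 1` and `θ ≥ 0`: `ofReal (a^θ) ≤ 1`. [folklore] -/
theorem ofReal_rpow_le_one {a θ : ℝ} (ha0 : 0 ≤ a) (ha : a ≤ 1) (hθ : 0 ≤ θ) :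
    ENNReal.ofReal (a ^ θ) ≤ 1 := by
  rw [← ENNReal.ofReal_one]
  exact ENNReal.ofReal_le_ofReal (Real.rpow_le_one ha0 ha hθ)

/-- For `0 ≤ a ≤ 1`: `ofReal (a^n) ≤ 1`. [folklore] -/
theorem ofReal_pow_le_one {a : ℝ} (ha0 : 0 ≤ a) (ha : a ≤ 1) (n : ℕ) :
    ENNReal.ofReal (a ^ n) ≤ 1 := by
  rw [← ENNReal.ofReal_one]
  exact ENNReal.ofReal_le_ofReal (pow_le_one₀ ha0 ha)

/-- The backward cylinder at the vertex, as a product set. [folklore] -/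
theorem parabolicCylinder_zero_eq (a : ℝ) :
    parabolicCylinder a (0 : ℝ × (EuclideanSpace ℝ (Fin 3))) = Ioo (-(a ^ 2)) (0 : ℝ) ×ˢ ball (0 : (EuclideanSpace ℝ (Fin 3))) a := by
  ext q
  simp [parabolicCylinder]

/-- Volume of the backward cylinder at the vertex: `|Q_a| = a² · (a³ |B₁|)`. [folklore] -/
theorem volume_parabolicCylinder_zero {a : ℝ} (ha0 : 0 < a) :
    volume (parabolicCylinder a (0 : ℝ × (EuclideanSpace ℝ (Fin 3)))) =
      ENNReal.ofReal (a ^ 2) * (ENNReal.ofReal (a ^ 3) * volume (ball (0 : (EuclideanSpace ℝ (Fin 3))) 1)) := by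
  rw [parabolicCylinder_zero_eq, Measure.volume_eq_prod, Measure.prod_prod, Real.volume_Ioo,
    Measure.addHaar_ball_of_pos volume 0 ha0, finrank_euclideanSpace_fin]
  simp

/-- For `0 < a ≤ 1` the backward cylinder `Q_a(0,0)` lies in the unit cylinder `(−1,0) × B₁`. [folklore] -/
theorem mem_unitCylinder_of_mem_parabolicCylinder {a : ℝ} (ha : a ≤ 1) {q : ℝ × (EuclideanSpace ℝ (Fin 3))}
    (hq : q ∈ parabolicCylinder a (0 : ℝ × (EuclideanSpace ℝ (Fin 3)))) : q.1 ∈ Ioo (-1 : ℝ) 0 ∧ q.2 ∈ ball (0 : (EuclideanSpace ℝ (Fin 3))) 1 := by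
  rw [parabolicCylinder_zero_eq] at hq
  obtain ⟨⟨h1, h2⟩, h3⟩ := hq
  have ha2 : a ^ 2 ≤ 1 := by
    have := mem_ball_zero_iff.1 h3
    nlinarith [norm_nonneg q.2]
  exact ⟨⟨by linarith, h2⟩, ball_subset_ball ha h3⟩

/-! ## Large scales `a ≥ 1`: the three global budgets -/

/-- Gauge `A` at scales `a ≥ 1` from the energy budget (`2ρ ≤ 1`). [folklore] -/
theorem gaugeA_le_of_energy {ρ : ℝ} (hρ : 2 * ρ ≤ 1) {u : ℝ → (EuclideanSpace ℝ (Fin 3)) → (EuclideanSpace ℝ (Fin 3))} {M : ℝ≥0∞}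
    (hA : ∀ t : ℝ, t < 0 → ∫⁻ x, ‖u t x‖ₑ ^ 2 ≤ M) {a : ℝ} (ha : 1 ≤ a) :
    ENNReal.ofReal (a ^ (2 * ρ)) * cknA a (0 : ℝ × (EuclideanSpace ℝ (Fin 3))) u ≤ M := by
  have ha0 : 0 < a := by linarith
  have hsup : cknA a (0 : ℝ × (EuclideanSpace ℝ (Fin 3))) u ≤ (ENNReal.ofReal a)⁻¹ * M := by
    simp only [cknA, Prod.fst_zero, Prod.snd_zero]
    refine iSup₂_le fun t ht => ?_
    exact mul_le_mul_right ((setLIntegral_le_lintegral _ _).trans (hA t ht.2)) _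
  calc ENNReal.ofReal (a ^ (2 * ρ)) * cknA a (0 : ℝ × (EuclideanSpace ℝ (Fin 3))) u
      ≤ ENNReal.ofReal (a ^ (2 * ρ)) * ((ENNReal.ofReal a)⁻¹ * M) := mul_le_mul_right hsup _
    _ ≤ M := mul_inv_mul_le_of_le (ofReal_rpow_le_ofReal ha hρ) (ENNReal.ofReal_pos.2 ha0).ne'
        ENNReal.ofReal_ne_top

/-- Gauge `E` at scales `a ≥ 1` from the space–time enstrophy budget (`ρ ≤ 1`). [folklore] -/
theorem gaugeE_le_of_enstrophy {ρ : ℝ} (hρ : ρ ≤ 1) {H : ℝ → (EuclideanSpace ℝ (Fin 3)) → (EuclideanSpace ℝ (Fin 3)) →L[ℝ] (EuclideanSpace ℝ (Fin 3))} {M : ℝ≥0∞}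
    (hE : ∫⁻ z in Iio (0 : ℝ) ×ˢ (univ : Set (EuclideanSpace ℝ (Fin 3))), ENNReal.ofReal (frobeniusNormSq (H z.1 z.2)) ≤ M)
    {a : ℝ} (ha : 1 ≤ a) :
    ENNReal.ofReal (a ^ ρ) * cknE a (0 : ℝ × (EuclideanSpace ℝ (Fin 3))) H ≤ M := by
  have ha0 : 0 < a := by linarith
  -- (the inclusion `Q_a(0,0) ⊆ (−∞,0) × ℝ³` is `…ZoomDictionary.parabolicCylinder_zero_subset_lowerHalf` elsewhere in the
  -- tree; re-derived inline to keep this file's imports minimal)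
  have hsub : parabolicCylinder a (0 : ℝ × (EuclideanSpace ℝ (Fin 3))) ⊆
      Iio (0 : ℝ) ×ˢ (univ : Set (EuclideanSpace ℝ (Fin 3))) := fun q hq => by
    rw [mem_parabolicCylinder] at hq
    exact ⟨by simpa using hq.1.2, mem_univ _⟩
  have hint : cknE a (0 : ℝ × (EuclideanSpace ℝ (Fin 3))) H ≤ (ENNReal.ofReal a)⁻¹ * M := by
    unfold cknE
    exact mul_le_mul_right ((lintegral_mono_set hsub).trans hE) _
  calc ENNReal.ofReal (a ^ ρ) * cknE a (0 : ℝ × (EuclideanSpace ℝ (Fin 3))) H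
      ≤ ENNReal.ofReal (a ^ ρ) * ((ENNReal.ofReal a)⁻¹ * M) := mul_le_mul_right hint _
    _ ≤ M := mul_inv_mul_le_of_le (ofReal_rpow_le_ofReal ha hρ) (ENNReal.ofReal_pos.2 ha0).ne'
        ENNReal.ofReal_ne_top

/-- Gauge `D` at scales `a ≥ 1` from the space–time pressure budget (`2ρ ≤ 1`). [folklore] -/
theorem gaugeD_le_of_pressure {ρ : ℝ} (hρ : 2 * ρ ≤ 1) {p : ℝ → (EuclideanSpace ℝ (Fin 3)) → ℝ} {M : ℝ≥0∞}
    (hD : ∫⁻ z in Iio (0 : ℝ) ×ˢ (univ : Set (EuclideanSpace ℝ (Fin 3))), ‖p z.1 z.2‖ₑ ^ (3 / 2 : ℝ) ≤ M)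
    {a : ℝ} (ha : 1 ≤ a) :
    ENNReal.ofReal (a ^ (2 * ρ)) * cknD a (0 : ℝ × (EuclideanSpace ℝ (Fin 3))) p ≤ M := by
  have ha0 : 0 < a := by linarith
  have h1 : 1 ≤ ENNReal.ofReal a := ENNReal.one_le_ofReal.2 ha
  have hne0 : ENNReal.ofReal a ^ 2 ≠ 0 := pow_ne_zero 2 (ENNReal.ofReal_pos.2 ha0).ne'
  have hnet : ENNReal.ofReal a ^ 2 ≠ ⊤ := ENNReal.pow_ne_top ENNReal.ofReal_ne_top
  have hsub : parabolicCylinder a (0 : ℝ × (EuclideanSpace ℝ (Fin 3))) ⊆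
      Iio (0 : ℝ) ×ˢ (univ : Set (EuclideanSpace ℝ (Fin 3))) := fun q hq => by
    rw [mem_parabolicCylinder] at hq
    exact ⟨by simpa using hq.1.2, mem_univ _⟩
  have hint : cknD a (0 : ℝ × (EuclideanSpace ℝ (Fin 3))) p ≤ (ENNReal.ofReal a ^ 2)⁻¹ * M := by
    unfold cknD
    exact mul_le_mul_right ((lintegral_mono_set hsub).trans hD) _
  have hle : ENNReal.ofReal (a ^ (2 * ρ)) ≤ ENNReal.ofReal a ^ 2 :=
    calc ENNReal.ofReal (a ^ (2 * ρ)) ≤ ENNReal.ofReal a := ofReal_rpow_le_ofReal ha hρ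
      _ = ENNReal.ofReal a ^ 1 := (pow_one _).symm
      _ ≤ ENNReal.ofReal a ^ 2 := pow_le_pow_right₀ h1 (by norm_num)
  calc ENNReal.ofReal (a ^ (2 * ρ)) * cknD a (0 : ℝ × (EuclideanSpace ℝ (Fin 3))) p
      ≤ ENNReal.ofReal (a ^ (2 * ρ)) * ((ENNReal.ofReal a ^ 2)⁻¹ * M) := mul_le_mul_right hint _
    _ ≤ M := mul_inv_mul_le_of_le hle hne0 hnet

/-! ## Small scales `0 < a ≤ 1`: the local bounds below the vertex -/

/-- Gauge `A` at scales `a ≤ 1` from a velocity bound on the unit cylinder (`ρ ≥ 0`). [folklore] -/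
theorem gaugeA_le_of_local {ρ : ℝ} (hρ : 0 ≤ ρ) {u : ℝ → (EuclideanSpace ℝ (Fin 3)) → (EuclideanSpace ℝ (Fin 3))} {K : ℝ}
    (hKu : ∀ t ∈ Ioo (-1 : ℝ) 0, ∀ x ∈ ball (0 : (EuclideanSpace ℝ (Fin 3))) 1, ‖u t x‖ ≤ K) {a : ℝ} (ha0 : 0 < a) (ha : a ≤ 1) :
    ENNReal.ofReal (a ^ (2 * ρ)) * cknA a (0 : ℝ × (EuclideanSpace ℝ (Fin 3))) u ≤
      ENNReal.ofReal (K ^ 2) * volume (ball (0 : (EuclideanSpace ℝ (Fin 3))) 1) := by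
  set v₁ := volume (ball (0 : (EuclideanSpace ℝ (Fin 3))) 1) with hv₁
  have hball : volume (ball (0 : (EuclideanSpace ℝ (Fin 3))) a) = ENNReal.ofReal (a ^ 3) * v₁ := by
    rw [Measure.addHaar_ball_of_pos volume 0 ha0, finrank_euclideanSpace_fin]
  have hslice : ∀ t ∈ Ioo (0 - a ^ 2) (0 : ℝ),
      ∫⁻ x in ball (0 : (EuclideanSpace ℝ (Fin 3))) a, ‖u t x‖ₑ ^ 2 ≤ ENNReal.ofReal (K ^ 2) * (ENNReal.ofReal (a ^ 3) * v₁) := by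
    intro t ht
    have ht' : t ∈ Ioo (-1 : ℝ) 0 := ⟨by nlinarith [ht.1], ht.2⟩
    calc ∫⁻ x in ball (0 : (EuclideanSpace ℝ (Fin 3))) a, ‖u t x‖ₑ ^ 2 ≤ ∫⁻ _ in ball (0 : (EuclideanSpace ℝ (Fin 3))) a, ENNReal.ofReal (K ^ 2) := by
          refine setLIntegral_mono measurable_const fun x hx => ?_
          rw [← ofReal_norm, ← ENNReal.ofReal_pow (norm_nonneg _)]
          exact ENNReal.ofReal_le_ofReal
            (pow_le_pow_left₀ (norm_nonneg _) (hKu t ht' x (ball_subset_ball ha hx)) 2)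
      _ = ENNReal.ofReal (K ^ 2) * (ENNReal.ofReal (a ^ 3) * v₁) := by rw [setLIntegral_const, hball]
  have hsup : cknA a (0 : ℝ × (EuclideanSpace ℝ (Fin 3))) u ≤
      (ENNReal.ofReal a)⁻¹ * (ENNReal.ofReal (K ^ 2) * (ENNReal.ofReal (a ^ 3) * v₁)) := by
    simp only [cknA, Prod.fst_zero, Prod.snd_zero]
    exact iSup₂_le fun t ht => mul_le_mul_right (hslice t ht) _
  have hfac : ENNReal.ofReal (a ^ (2 * ρ)) * ((ENNReal.ofReal a)⁻¹ * ENNReal.ofReal (a ^ 3)) ≤ 1 := by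
    rw [← ENNReal.ofReal_inv_of_pos ha0, ← ENNReal.ofReal_mul (inv_nonneg.2 ha0.le)]
    have h2 : a⁻¹ * a ^ 3 = a ^ 2 := by field_simp
    rw [h2]
    calc ENNReal.ofReal (a ^ (2 * ρ)) * ENNReal.ofReal (a ^ 2) ≤ 1 * 1 :=
          mul_le_mul' (ofReal_rpow_le_one ha0.le ha (by linarith)) (ofReal_pow_le_one ha0.le ha 2)
      _ = 1 := one_mul 1
  calc ENNReal.ofReal (a ^ (2 * ρ)) * cknA a (0 : ℝ × (EuclideanSpace ℝ (Fin 3))) u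
      ≤ ENNReal.ofReal (a ^ (2 * ρ)) *
          ((ENNReal.ofReal a)⁻¹ * (ENNReal.ofReal (K ^ 2) * (ENNReal.ofReal (a ^ 3) * v₁))) :=
        mul_le_mul_right hsup _
    _ = (ENNReal.ofReal (a ^ (2 * ρ)) * ((ENNReal.ofReal a)⁻¹ * ENNReal.ofReal (a ^ 3))) *
          (ENNReal.ofReal (K ^ 2) * v₁) := by ring
    _ ≤ 1 * (ENNReal.ofReal (K ^ 2) * v₁) := mul_le_mul_left hfac _
    _ = ENNReal.ofReal (K ^ 2) * v₁ := one_mul _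

/-- Gauge `E` at scales `a ≤ 1` from a gradient bound on the unit cylinder (`ρ ≥ 0`). [folklore] -/
theorem gaugeE_le_of_local {ρ : ℝ} (hρ : 0 ≤ ρ) {H : ℝ → (EuclideanSpace ℝ (Fin 3)) → (EuclideanSpace ℝ (Fin 3)) →L[ℝ] (EuclideanSpace ℝ (Fin 3))} {K : ℝ}
    (hKH : ∀ t ∈ Ioo (-1 : ℝ) 0, ∀ x ∈ ball (0 : (EuclideanSpace ℝ (Fin 3))) 1, frobeniusNormSq (H t x) ≤ K)
    {a : ℝ} (ha0 : 0 < a) (ha : a ≤ 1) :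
    ENNReal.ofReal (a ^ ρ) * cknE a (0 : ℝ × (EuclideanSpace ℝ (Fin 3))) H ≤ ENNReal.ofReal K * volume (ball (0 : (EuclideanSpace ℝ (Fin 3))) 1) := by
  set v₁ := volume (ball (0 : (EuclideanSpace ℝ (Fin 3))) 1) with hv₁
  have hint : ∫⁻ q in parabolicCylinder a (0 : ℝ × (EuclideanSpace ℝ (Fin 3))), ENNReal.ofReal (frobeniusNormSq (H q.1 q.2)) ≤
      ENNReal.ofReal K * (ENNReal.ofReal (a ^ 2) * (ENNReal.ofReal (a ^ 3) * v₁)) := by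
    calc ∫⁻ q in parabolicCylinder a (0 : ℝ × (EuclideanSpace ℝ (Fin 3))), ENNReal.ofReal (frobeniusNormSq (H q.1 q.2))
        ≤ ∫⁻ _ in parabolicCylinder a (0 : ℝ × (EuclideanSpace ℝ (Fin 3))), ENNReal.ofReal K := by
          refine setLIntegral_mono measurable_const fun q hq => ?_
          obtain ⟨h1, h2⟩ := mem_unitCylinder_of_mem_parabolicCylinder ha hq
          exact ENNReal.ofReal_le_ofReal (hKH q.1 h1 q.2 h2)
      _ = ENNReal.ofReal K * (ENNReal.ofReal (a ^ 2) * (ENNReal.ofReal (a ^ 3) * v₁)) := by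
          rw [setLIntegral_const, volume_parabolicCylinder_zero ha0]
  have hfac : ENNReal.ofReal (a ^ ρ) *
      ((ENNReal.ofReal a)⁻¹ * (ENNReal.ofReal (a ^ 2) * ENNReal.ofReal (a ^ 3))) ≤ 1 := by
    rw [← ENNReal.ofReal_inv_of_pos ha0, ← ENNReal.ofReal_mul (sq_nonneg a),
      ← ENNReal.ofReal_mul (inv_nonneg.2 ha0.le)]
    have h4 : a⁻¹ * (a ^ 2 * a ^ 3) = a ^ 4 := by field_simp
    rw [h4]
    calc ENNReal.ofReal (a ^ ρ) * ENNReal.ofReal (a ^ 4) ≤ 1 * 1 :=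
          mul_le_mul' (ofReal_rpow_le_one ha0.le ha hρ) (ofReal_pow_le_one ha0.le ha 4)
      _ = 1 := one_mul 1
  calc ENNReal.ofReal (a ^ ρ) * cknE a (0 : ℝ × (EuclideanSpace ℝ (Fin 3))) H
      ≤ ENNReal.ofReal (a ^ ρ) * ((ENNReal.ofReal a)⁻¹ *
          (ENNReal.ofReal K * (ENNReal.ofReal (a ^ 2) * (ENNReal.ofReal (a ^ 3) * v₁)))) := by
        unfold cknE
        exact mul_le_mul_right (mul_le_mul_right hint _) _
    _ = (ENNReal.ofReal (a ^ ρ) *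
          ((ENNReal.ofReal a)⁻¹ * (ENNReal.ofReal (a ^ 2) * ENNReal.ofReal (a ^ 3)))) *
          (ENNReal.ofReal K * v₁) := by ring
    _ ≤ 1 * (ENNReal.ofReal K * v₁) := mul_le_mul_left hfac _
    _ = ENNReal.ofReal K * v₁ := one_mul _

/-- Gauge `D` at scales `a ≤ 1` from a pressure bound on the unit cylinder (`ρ ≥ 0`). [folklore] -/
theorem gaugeD_le_of_local {ρ : ℝ} (hρ : 0 ≤ ρ) {p : ℝ → (EuclideanSpace ℝ (Fin 3)) → ℝ} {K : ℝ}
    (hKp : ∀ t ∈ Ioo (-1 : ℝ) 0, ∀ x ∈ ball (0 : (EuclideanSpace ℝ (Fin 3))) 1, ‖p t x‖ ≤ K)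
    {a : ℝ} (ha0 : 0 < a) (ha : a ≤ 1) :
    ENNReal.ofReal (a ^ (2 * ρ)) * cknD a (0 : ℝ × (EuclideanSpace ℝ (Fin 3))) p ≤
      ENNReal.ofReal K ^ (3 / 2 : ℝ) * volume (ball (0 : (EuclideanSpace ℝ (Fin 3))) 1) := by
  set v₁ := volume (ball (0 : (EuclideanSpace ℝ (Fin 3))) 1) with hv₁
  set Cp : ℝ≥0∞ := ENNReal.ofReal K ^ (3 / 2 : ℝ) with hCp
  have hint : ∫⁻ q in parabolicCylinder a (0 : ℝ × (EuclideanSpace ℝ (Fin 3))), ‖p q.1 q.2‖ₑ ^ (3 / 2 : ℝ) ≤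
      Cp * (ENNReal.ofReal (a ^ 2) * (ENNReal.ofReal (a ^ 3) * v₁)) := by
    calc ∫⁻ q in parabolicCylinder a (0 : ℝ × (EuclideanSpace ℝ (Fin 3))), ‖p q.1 q.2‖ₑ ^ (3 / 2 : ℝ)
        ≤ ∫⁻ _ in parabolicCylinder a (0 : ℝ × (EuclideanSpace ℝ (Fin 3))), Cp := by
          refine setLIntegral_mono measurable_const fun q hq => ?_
          obtain ⟨h1, h2⟩ := mem_unitCylinder_of_mem_parabolicCylinder ha hq
          refine ENNReal.rpow_le_rpow ?_ (by norm_num)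
          rw [← ofReal_norm]
          exact ENNReal.ofReal_le_ofReal (hKp q.1 h1 q.2 h2)
      _ = Cp * (ENNReal.ofReal (a ^ 2) * (ENNReal.ofReal (a ^ 3) * v₁)) := by
          rw [setLIntegral_const, volume_parabolicCylinder_zero ha0]
  have hsq : ENNReal.ofReal a ^ 2 = ENNReal.ofReal (a ^ 2) := (ENNReal.ofReal_pow ha0.le 2).symm
  have hne0 : ENNReal.ofReal (a ^ 2) ≠ 0 := (ENNReal.ofReal_pos.2 (by positivity)).ne'
  have hfac : ENNReal.ofReal (a ^ (2 * ρ)) *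
      ((ENNReal.ofReal a ^ 2)⁻¹ * (ENNReal.ofReal (a ^ 2) * ENNReal.ofReal (a ^ 3))) ≤ 1 := by
    rw [hsq, ← mul_assoc (ENNReal.ofReal (a ^ 2))⁻¹, ENNReal.inv_mul_cancel hne0 ENNReal.ofReal_ne_top,
      one_mul]
    calc ENNReal.ofReal (a ^ (2 * ρ)) * ENNReal.ofReal (a ^ 3) ≤ 1 * 1 :=
          mul_le_mul' (ofReal_rpow_le_one ha0.le ha (by linarith)) (ofReal_pow_le_one ha0.le ha 3)
      _ = 1 := one_mul 1
  calc ENNReal.ofReal (a ^ (2 * ρ)) * cknD a (0 : ℝ × (EuclideanSpace ℝ (Fin 3))) p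
      ≤ ENNReal.ofReal (a ^ (2 * ρ)) * ((ENNReal.ofReal a ^ 2)⁻¹ *
          (Cp * (ENNReal.ofReal (a ^ 2) * (ENNReal.ofReal (a ^ 3) * v₁)))) := by
        unfold cknD
        exact mul_le_mul_right (mul_le_mul_right hint _) _
    _ = (ENNReal.ofReal (a ^ (2 * ρ)) *
          ((ENNReal.ofReal a ^ 2)⁻¹ * (ENNReal.ofReal (a ^ 2) * ENNReal.ofReal (a ^ 3)))) * (Cp * v₁) := by
        ring
    _ ≤ 1 * (Cp * v₁) := mul_le_mul_left hfac _
    _ = Cp * v₁ := one_mul _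

/-! ## All scales: the power-gauged bound of the crux, for every `ρ ∈ [0, ½]` -/

/-- **Three finite global budgets + local bounds below the vertex ⇒ Seregin's power-gauged bound at the vertex for EVERY
`ρ ∈ [0, ½]`**, with one constant `c` (independent of `a > 0`). [folklore] -/
theorem powerGauge_le_of_budgets {ρ : ℝ} (hρ0 : 0 ≤ ρ) (hρ : ρ ≤ 1 / 2)
    {u : ℝ → (EuclideanSpace ℝ (Fin 3)) → (EuclideanSpace ℝ (Fin 3))} {p : ℝ → (EuclideanSpace ℝ (Fin 3)) → ℝ} {H : ℝ → (EuclideanSpace ℝ (Fin 3)) → (EuclideanSpace ℝ (Fin 3)) →L[ℝ] (EuclideanSpace ℝ (Fin 3))} {M : ℝ≥0} {K : ℝ}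
    (hA : ∀ t : ℝ, t < 0 → ∫⁻ x, ‖u t x‖ₑ ^ 2 ≤ (M : ℝ≥0∞))
    (hE : ∫⁻ z in Iio (0 : ℝ) ×ˢ (univ : Set (EuclideanSpace ℝ (Fin 3))), ENNReal.ofReal (frobeniusNormSq (H z.1 z.2)) ≤ (M : ℝ≥0∞))
    (hD : ∫⁻ z in Iio (0 : ℝ) ×ˢ (univ : Set (EuclideanSpace ℝ (Fin 3))), ‖p z.1 z.2‖ₑ ^ (3 / 2 : ℝ) ≤ (M : ℝ≥0∞))
    (hKu : ∀ t ∈ Ioo (-1 : ℝ) 0, ∀ x ∈ ball (0 : (EuclideanSpace ℝ (Fin 3))) 1, ‖u t x‖ ≤ K)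
    (hKH : ∀ t ∈ Ioo (-1 : ℝ) 0, ∀ x ∈ ball (0 : (EuclideanSpace ℝ (Fin 3))) 1, frobeniusNormSq (H t x) ≤ K)
    (hKp : ∀ t ∈ Ioo (-1 : ℝ) 0, ∀ x ∈ ball (0 : (EuclideanSpace ℝ (Fin 3))) 1, ‖p t x‖ ≤ K) :
    ∃ c : ℝ≥0, ∀ a : ℝ, 0 < a →
      ENNReal.ofReal (a ^ (2 * ρ)) * cknA a (0 : ℝ × (EuclideanSpace ℝ (Fin 3))) u + ENNReal.ofReal (a ^ ρ) * cknE a (0 : ℝ × (EuclideanSpace ℝ (Fin 3))) H +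
        ENNReal.ofReal (a ^ (2 * ρ)) * cknD a (0 : ℝ × (EuclideanSpace ℝ (Fin 3))) p ≤ (c : ℝ≥0∞) := by
  set v₁ := volume (ball (0 : (EuclideanSpace ℝ (Fin 3))) 1) with hv₁
  have hv : v₁ ≠ ⊤ := measure_ball_lt_top.ne
  set Cbig : ℝ≥0∞ := (M : ℝ≥0∞) + M + M with hCbig
  set Csmall : ℝ≥0∞ := ENNReal.ofReal (K ^ 2) * v₁ + ENNReal.ofReal K * v₁ +
    ENNReal.ofReal K ^ (3 / 2 : ℝ) * v₁ with hCsmall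
  have hbig : Cbig ≠ ⊤ := by simp [hCbig]
  have hsmall : Csmall ≠ ⊤ := by
    refine ENNReal.add_ne_top.2 ⟨ENNReal.add_ne_top.2 ⟨ENNReal.mul_ne_top ENNReal.ofReal_ne_top hv,
      ENNReal.mul_ne_top ENNReal.ofReal_ne_top hv⟩, ENNReal.mul_ne_top ?_ hv⟩
    exact ENNReal.rpow_ne_top_of_nonneg (by norm_num) ENNReal.ofReal_ne_top
  have htot : Cbig + Csmall ≠ ⊤ := ENNReal.add_ne_top.2 ⟨hbig, hsmall⟩
  refine ⟨(Cbig + Csmall).toNNReal, fun a ha0 => ?_⟩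
  rw [ENNReal.coe_toNNReal htot]
  have h2ρ : 2 * ρ ≤ 1 := by linarith
  have hρ1 : ρ ≤ 1 := by linarith
  by_cases ha : 1 ≤ a
  · calc _ ≤ Cbig := add_le_add (add_le_add (gaugeA_le_of_energy h2ρ hA ha) (gaugeE_le_of_enstrophy hρ1 hE ha))
          (gaugeD_le_of_pressure h2ρ hD ha)
      _ ≤ Cbig + Csmall := le_self_add
  · have ha1 : a ≤ 1 := (not_le.1 ha).le
    calc _ ≤ Csmall := add_le_add (add_le_add (gaugeA_le_of_local hρ0 hKu ha0 ha1)
          (gaugeE_le_of_local hρ0 hKH ha0 ha1)) (gaugeD_le_of_local hρ0 hKp ha0 ha1)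
      _ ≤ Cbig + Csmall := le_add_self

/-! ## Classical ancient flows: the class hypotheses of the crux verbatim -/

/-- **A budgeted classical ancient Euler flow satisfies the three hypotheses of `PowerGaugeEulerLiouville` for every
`ρ ∈ [0, ½]`.**  For a classical Euler flow `(u,p)` on `(−∞,0) × ℝ³` with the three finite global budgets and local
bounds on the unit cylinder below the vertex, the pair `(u,p)` is a suitable weak (`ν = 0`, `f = 0`) pair on the slab
(CKN (2.5) with equality, `isSuitableWeakSolutionOn_of_contDiffOn`), its classical slice derivative is a weak spatial
gradient, and the power-gauged bound holds at the vertex for all `a > 0`. [folklore] -/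
theorem powerGauge_hypotheses_of_budgets {ρ : ℝ} (hρ0 : 0 ≤ ρ) (hρ : ρ ≤ 1 / 2)
    {u : ℝ → (EuclideanSpace ℝ (Fin 3)) → (EuclideanSpace ℝ (Fin 3))} {p : ℝ → (EuclideanSpace ℝ (Fin 3)) → ℝ} {M : ℝ≥0} {K : ℝ}
    (hsol : IsClassicalEulerSolutionOn (Iio (0 : ℝ)) 0 u p)
    (hA : ∀ t : ℝ, t < 0 → ∫⁻ x, ‖u t x‖ₑ ^ 2 ≤ (M : ℝ≥0∞))
    (hE : ∫⁻ z in Iio (0 : ℝ) ×ˢ (univ : Set (EuclideanSpace ℝ (Fin 3))),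
      ENNReal.ofReal (frobeniusNormSq (fderiv ℝ (u z.1) z.2)) ≤ (M : ℝ≥0∞))
    (hD : ∫⁻ z in Iio (0 : ℝ) ×ˢ (univ : Set (EuclideanSpace ℝ (Fin 3))), ‖p z.1 z.2‖ₑ ^ (3 / 2 : ℝ) ≤ (M : ℝ≥0∞))
    (hKu : ∀ t ∈ Ioo (-1 : ℝ) 0, ∀ x ∈ ball (0 : (EuclideanSpace ℝ (Fin 3))) 1, ‖u t x‖ ≤ K)
    (hKH : ∀ t ∈ Ioo (-1 : ℝ) 0, ∀ x ∈ ball (0 : (EuclideanSpace ℝ (Fin 3))) 1, frobeniusNormSq (fderiv ℝ (u t) x) ≤ K)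
    (hKp : ∀ t ∈ Ioo (-1 : ℝ) 0, ∀ x ∈ ball (0 : (EuclideanSpace ℝ (Fin 3))) 1, ‖p t x‖ ≤ K) :
    ∃ c : ℝ≥0,
      IsSuitableWeakSolutionOn (slab (EuclideanSpace ℝ (Fin 3)) (Iio 0) isOpen_Iio) 0 0 u p ∧
      HasWeakSpatialGradientOn (slab (EuclideanSpace ℝ (Fin 3)) (Iio 0) isOpen_Iio) u
        (fun t x => fderiv ℝ (u t) x) ∧
      ∀ a : ℝ, 0 < a →
        ENNReal.ofReal (a ^ (2 * ρ)) * cknA a (0 : ℝ × (EuclideanSpace ℝ (Fin 3))) u +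
            ENNReal.ofReal (a ^ ρ) * cknE a (0 : ℝ × (EuclideanSpace ℝ (Fin 3))) (fun t x => fderiv ℝ (u t) x) +
          ENNReal.ofReal (a ^ (2 * ρ)) * cknD a (0 : ℝ × (EuclideanSpace ℝ (Fin 3))) p ≤ (c : ℝ≥0∞) := by
  have hQ : ((slab (EuclideanSpace ℝ (Fin 3)) (Iio 0) isOpen_Iio : TopologicalSpace.Opens (ℝ × (EuclideanSpace ℝ (Fin 3)))) :
      Set (ℝ × (EuclideanSpace ℝ (Fin 3)))) ⊆ Iio (0 : ℝ) ×ˢ univ := (coe_slab _ _).subset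
  have huInf : ContDiffOn ℝ (⊤ : ℕ∞) (uncurry u) (Iio (0 : ℝ) ×ˢ univ) := hsol.smooth_velocity
  have hpInf : ContDiffOn ℝ (⊤ : ℕ∞) (uncurry p) (Iio (0 : ℝ) ×ˢ univ) := hsol.smooth_pressure
  have hu2 : ContDiffOn ℝ 2 (uncurry u) (Iio (0 : ℝ) ×ˢ univ) := huInf.of_le (by norm_cast)
  have hu1 : ContDiffOn ℝ 1 (uncurry u) (Iio (0 : ℝ) ×ˢ univ) := huInf.of_le (by norm_cast)
  have hp1 : ContDiffOn ℝ 1 (uncurry p) (Iio (0 : ℝ) ×ˢ univ) := hpInf.of_le (by norm_cast)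
  have hmom : ∀ t ∈ Iio (0 : ℝ), ∀ x : (EuclideanSpace ℝ (Fin 3)), timeDeriv u t x + convect (u t) (u t) x =
      (0 : ℝ) • (Δ (u t)) x - gradient (p t) x + (0 : ℝ → (EuclideanSpace ℝ (Fin 3)) → (EuclideanSpace ℝ (Fin 3))) t x := by
    intro t ht x
    have hint : t ∈ interior (Iio (0 : ℝ)) := by rwa [interior_Iio]
    rw [← timeDerivWithin_of_mem_interior hint x]
    exact hsol.momentum t ht x
  have hsw : IsSuitableWeakSolutionOn (slab (EuclideanSpace ℝ (Fin 3)) (Iio 0) isOpen_Iio) 0 0 u p :=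
    isSuitableWeakSolutionOn_of_contDiffOn isOpen_Iio hQ hu2 hp1 continuousOn_const hmom hsol.divFree
  have hH : HasWeakSpatialGradientOn (slab (EuclideanSpace ℝ (Fin 3)) (Iio 0) isOpen_Iio) u
      (fun t x => fderiv ℝ (u t) x) :=
    hasWeakSpatialGradientOn_of_contDiffOn isOpen_Iio hQ hu1
  obtain ⟨c, hc⟩ := powerGauge_le_of_budgets (H := fun t x => fderiv ℝ (u t) x) hρ0 hρ hA hE hD hKu hKH hKp
  exact ⟨c, hsw, hH, hc⟩

/-- A field that is continuous on the slab and nonzero at one point of it is not a.e. zero there. [folklore] -/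
theorem not_ae_eq_zero_of_continuousOn {u : ℝ → (EuclideanSpace ℝ (Fin 3)) → (EuclideanSpace ℝ (Fin 3))}
    (hu : ContinuousOn (uncurry u) (Iio (0 : ℝ) ×ˢ (univ : Set (EuclideanSpace ℝ (Fin 3)))))
    {t₀ : ℝ} (ht₀ : t₀ < 0) {x₀ : (EuclideanSpace ℝ (Fin 3))} (hne : u t₀ x₀ ≠ 0) :
    ¬ (uncurry u =ᵐ[volume.restrict (Iio (0 : ℝ) ×ˢ (univ : Set (EuclideanSpace ℝ (Fin 3))))] 0) := by
  intro hae
  set S : Set (ℝ × (EuclideanSpace ℝ (Fin 3))) := Iio (0 : ℝ) ×ˢ (univ : Set (EuclideanSpace ℝ (Fin 3))) with hS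
  have hSo : IsOpen S := isOpen_Iio.prod isOpen_univ
  set U : Set (ℝ × (EuclideanSpace ℝ (Fin 3))) := S ∩ uncurry u ⁻¹' ({0}ᶜ) with hU
  have hUo : IsOpen U := hu.isOpen_inter_preimage hSo isOpen_compl_singleton
  have hmem : ((t₀, x₀) : ℝ × (EuclideanSpace ℝ (Fin 3))) ∈ U := ⟨⟨ht₀, mem_univ _⟩, hne⟩
  have hpos : 0 < volume U := hUo.measure_pos volume ⟨_, hmem⟩
  have hzero : volume {z : ℝ × (EuclideanSpace ℝ (Fin 3)) | ¬ (z ∈ S → uncurry u z = (0 : ℝ × (EuclideanSpace ℝ (Fin 3)) → (EuclideanSpace ℝ (Fin 3))) z)} = 0 :=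
    ae_iff.1 ((ae_restrict_iff' hSo.measurableSet).1 hae)
  have hsub : U ⊆ {z : ℝ × (EuclideanSpace ℝ (Fin 3)) | ¬ (z ∈ S → uncurry u z = (0 : ℝ × (EuclideanSpace ℝ (Fin 3)) → (EuclideanSpace ℝ (Fin 3))) z)} := by
    intro z hz h
    exact hz.2 (h hz.1)
  exact hpos.ne' (measure_mono_null hsub hzero)

/-- **NEGATIVE EDGE (¬ crux modulo a budgeted classical ancient flow).**  If there is a classical Euler flow `(u,p)` on
`(−∞,0) × ℝ³`, nonzero at one point, with finite global energy, finite space–time enstrophy and finite space–time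
`L^{3/2}` pressure budgets, and bounded velocity / gradient / pressure on the unit cylinder below the vertex, then the
crux `PowerGaugeEulerLiouville` (stmt-19832) FAILS — indeed at every `ρ ∈ (0, ½]`, here instantiated at `ρ = ½`.
By time reversal such a flow is the same thing as a FORWARD global classical finite-energy Euler flow with
square-summable enstrophy (see the module docstring); none is known.  Nothing is constructed here. [folklore] -/
theorem powerGaugeEulerLiouville_false_of_ancientBudgetedClassicalFlow
    {u : ℝ → (EuclideanSpace ℝ (Fin 3)) → (EuclideanSpace ℝ (Fin 3))} {p : ℝ → (EuclideanSpace ℝ (Fin 3)) → ℝ} {M : ℝ≥0} {K : ℝ}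
    (hsol : IsClassicalEulerSolutionOn (Iio (0 : ℝ)) 0 u p)
    (hA : ∀ t : ℝ, t < 0 → ∫⁻ x, ‖u t x‖ₑ ^ 2 ≤ (M : ℝ≥0∞))
    (hE : ∫⁻ z in Iio (0 : ℝ) ×ˢ (univ : Set (EuclideanSpace ℝ (Fin 3))),
      ENNReal.ofReal (frobeniusNormSq (fderiv ℝ (u z.1) z.2)) ≤ (M : ℝ≥0∞))
    (hD : ∫⁻ z in Iio (0 : ℝ) ×ˢ (univ : Set (EuclideanSpace ℝ (Fin 3))), ‖p z.1 z.2‖ₑ ^ (3 / 2 : ℝ) ≤ (M : ℝ≥0∞))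
    (hKu : ∀ t ∈ Ioo (-1 : ℝ) 0, ∀ x ∈ ball (0 : (EuclideanSpace ℝ (Fin 3))) 1, ‖u t x‖ ≤ K)
    (hKH : ∀ t ∈ Ioo (-1 : ℝ) 0, ∀ x ∈ ball (0 : (EuclideanSpace ℝ (Fin 3))) 1, frobeniusNormSq (fderiv ℝ (u t) x) ≤ K)
    (hKp : ∀ t ∈ Ioo (-1 : ℝ) 0, ∀ x ∈ ball (0 : (EuclideanSpace ℝ (Fin 3))) 1, ‖p t x‖ ≤ K)
    {t₀ : ℝ} (ht₀ : t₀ < 0) {x₀ : (EuclideanSpace ℝ (Fin 3))} (hne : u t₀ x₀ ≠ 0) :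
    ¬ Summit.NavierStokesRegularity.NavierStokesRegularity.Theses.EulerZoomLiouville.PowerGaugeEulerLiouville := by
  intro hcrux
  obtain ⟨c, hsw, hH, hc⟩ := powerGauge_hypotheses_of_budgets (ρ := 1 / 2) (by norm_num) le_rfl
    hsol hA hE hD hKu hKH hKp
  have hae := hcrux (1 / 2) (by norm_num) u p (fun t x => fderiv ℝ (u t) x) c hsw hH hc
  exact not_ae_eq_zero_of_continuousOn hsol.smooth_velocity.continuousOn ht₀ hne hae

end Summit.NavierStokesRegularity.NavierStokesRegularity.Theorems.PowerGaugeEulerLiouville.Negative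
end
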